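import Summits.CriticalPhenomena.Ising3DConformalLimit.Theorems.ReflectionTwinExistsContinuousLimitReduction
import HarnessLib

/-!
# Where the open stub TD of line `Sketch` sits: TD ⟸ item 4659 ⟸ the crux, and TD ⟺ item 4659 under
# item 6150 ∧ K1′ (crux `ExistsContinuousLimit`, stmt-CriticalPhenomena-4582; registered sub-goals
# `isolatedConformalClusterPoints_of_clusterSetTotallyDisconnected`, `isolatedConformalClusterPoints_of_existsContinuousLimit`)

TD = `stub_isolatedConformalClusterPoints` (OPEN): the non-degenerate Möbius-covariant members of the cluster set of
item 4659 `ClusterRigidity.ClusterSetTotallyDisconnected` form a totally disconnected subset of `CorrFamily 3`.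
* TD is NECESSARY: item 4659 ⟹ TD by monotonicity of total disconnectedness (`isTotallyDisconnected_mono`, absent
  from Mathlib by name), and the crux ⟹ item 4659 is landed (`clusterSetTotallyDisconnected_of_existsContinuousLimit`,
  p149785), so crux ⟹ TD: a refutation of TD refutes the crux itself.
* Under item 6150 ∧ K1′ the two sets coincide (`clusterSet_eq_conformal`, p156070), so TD ⟺ item 4659 there
  (`clusterSetTotallyDisconnected_iff_isolated`).
Hence of the line's two open stubs only K1′ (inversion covariance of cluster points) is not implied by the crux.
[folklore]
-/

noncomputable section

namespace Summit.CriticalPhenomena.Ising3DConformalLimit.ReflectionTwinExistsContinuousLimit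

open Literature.Probability.LatticeModels Filter Set
open scoped Topology
open Summit.CriticalPhenomena.Ising3DConformalLimit.MoebiusLimitExistsOnlyInteraction (IsClusterPoint)
open Summit.CriticalPhenomena.Ising3DConformalLimit.Theses
open Summit.CriticalPhenomena.Ising3DConformalLimit.LogPolarProxyExistsContinuousLimit
  (clusterSetTotallyDisconnected_of_existsContinuousLimit)

/-- Monotonicity of `IsTotallyDisconnected` in the set (the definition applied to the smaller set). [folklore] -/
theorem isTotallyDisconnected_mono {α : Type*} [TopologicalSpace α] {s s' : Set α}
    (h : IsTotallyDisconnected s') (hsub : s ⊆ s') : IsTotallyDisconnected s :=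
  fun t ht hpc => h t (ht.trans hsub) hpc

/-- **Registered sub-goal `isolatedConformalClusterPoints_of_clusterSetTotallyDisconnected`: item 4659 ⟹ TD**
(verbatim stub statement), by monotonicity. [folklore] -/
theorem isolatedConformalClusterPoints_of_clusterSetTotallyDisconnected :
    Summit.CriticalPhenomena.Ising3DConformalLimit.Theses.ClusterRigidity.ClusterSetTotallyDisconnected →
    IsTotallyDisconnected {S : Literature.Probability.LatticeModels.CorrFamily 3 |
      ((∀ n x, x ∉ Literature.Probability.LatticeModels.NonCoincident 3 n → S n x = 0) ∧
        ∃ u : ℕ → ℝ, (∀ k, u k ∈ Set.Ioc (0:ℝ) 1) ∧ Filter.Tendsto u Filter.atTop (nhds 0) ∧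
          ∀ n, TendstoLocallyUniformlyOn
            (fun k => Literature.Probability.LatticeModels.rescaledCorrelator
              (Literature.Probability.LatticeModels.criticalCorr 3)
              (fun δ : ℝ => (Literature.Probability.LatticeModels.criticalTwoPoint 3 (Pi.single 0 ⌊δ⁻¹⌋)) ^
                (-(1/2:ℝ))) n (u k))
            (S n) Filter.atTop (Literature.Probability.LatticeModels.NonCoincident 3 n)) ∧
      Literature.Probability.LatticeModels.IsNondegenerateTwoPoint S ∧
      ∃ Δ : ℝ, Literature.Probability.LatticeModels.IsMoebiusCovariant Δ S} :=
  fun h => isTotallyDisconnected_mono h (fun _ hS => hS.1)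

/-- **Registered sub-goal `isolatedConformalClusterPoints_of_existsContinuousLimit`: the crux ⟹ TD** (TD is a
NECESSARY condition: crux ⟹ item 4659, p149785, then monotonicity). [folklore] -/
theorem isolatedConformalClusterPoints_of_existsContinuousLimit :
    Summit.CriticalPhenomena.Ising3DConformalLimit.Theses.ReflectionTwin.ExistsContinuousLimit →
    IsTotallyDisconnected {S : Literature.Probability.LatticeModels.CorrFamily 3 |
      ((∀ n x, x ∉ Literature.Probability.LatticeModels.NonCoincident 3 n → S n x = 0) ∧
        ∃ u : ℕ → ℝ, (∀ k, u k ∈ Set.Ioc (0:ℝ) 1) ∧ Filter.Tendsto u Filter.atTop (nhds 0) ∧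
          ∀ n, TendstoLocallyUniformlyOn
            (fun k => Literature.Probability.LatticeModels.rescaledCorrelator
              (Literature.Probability.LatticeModels.criticalCorr 3)
              (fun δ : ℝ => (Literature.Probability.LatticeModels.criticalTwoPoint 3 (Pi.single 0 ⌊δ⁻¹⌋)) ^
                (-(1/2:ℝ))) n (u k))
            (S n) Filter.atTop (Literature.Probability.LatticeModels.NonCoincident 3 n)) ∧
      Literature.Probability.LatticeModels.IsNondegenerateTwoPoint S ∧
      ∃ Δ : ℝ, Literature.Probability.LatticeModels.IsMoebiusCovariant Δ S} :=
  fun h => isolatedConformalClusterPoints_of_clusterSetTotallyDisconnected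
    (clusterSetTotallyDisconnected_of_existsContinuousLimit h)

/-- **Under item 6150 ∧ K1′, TD ⟺ item 4659** (the two sets coincide, `clusterSet_eq_conformal`). [folklore] -/
theorem clusterSetTotallyDisconnected_iff_isolated (hD : MirrorHoelderCompactness.TwoPointDoubling)
    (hK1 : ∀ S : CorrFamily 3, (∀ n z, z ∉ NonCoincident 3 n → S n z = 0) → IsClusterPoint S →
      ∃ w : EuclideanSpace ℝ (Fin 3) → ℝ, (∀ v, v ≠ 0 → 0 < w v) ∧ ContinuousOn w {0}ᶜ ∧
        ∀ (n : ℕ) (x : Fin n → EuclideanSpace ℝ (Fin 3)), (∀ i, x i ≠ 0) →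
          S n (fun i => EuclideanGeometry.inversion (0 : EuclideanSpace ℝ (Fin 3)) 1 (x i)) =
            (∏ i, w (x i)) * S n x) :
    ClusterRigidity.ClusterSetTotallyDisconnected ↔
    IsTotallyDisconnected {S : CorrFamily 3 |
      ((∀ n x, x ∉ NonCoincident 3 n → S n x = 0) ∧
        ∃ u : ℕ → ℝ, (∀ k, u k ∈ Set.Ioc (0:ℝ) 1) ∧ Tendsto u atTop (𝓝 0) ∧
          ∀ n, TendstoLocallyUniformlyOn
            (fun k => rescaledCorrelator (criticalCorr 3)
              (fun δ : ℝ => (criticalTwoPoint 3 (Pi.single 0 ⌊δ⁻¹⌋)) ^ (-(1/2:ℝ))) n (u k))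
            (S n) atTop (NonCoincident 3 n)) ∧
      IsNondegenerateTwoPoint S ∧ ∃ Δ : ℝ, IsMoebiusCovariant Δ S} := by
  unfold ClusterRigidity.ClusterSetTotallyDisconnected
  rw [clusterSet_eq_conformal hD hK1]

end Summit.CriticalPhenomena.Ising3DConformalLimit.ReflectionTwinExistsContinuousLimit

end
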